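import Mathlib.Analysis.MeanInequalities
import Mathlib.Analysis.MeanInequalitiesPow
import Mathlib.Analysis.SpecialFunctions.Pow.Real
import Mathlib.Algebra.BigOperators.Group.Finset.Powerset
import Mathlib.Data.Nat.Choose.Sum
import Mathlib.Data.Finset.Piecewise
import HarnessLib

/-!
# The orthogonal decomposition of functions on a finite uniform product space

Infrastructure (R. O'Donnell, *Analysis of Boolean Functions*, CUP 2014, Ch. 8, §8.3 "Orthogonal
decomposition") for Bourgain's sharp threshold theorem (`BourgainSharpThreshold.lean`) and through
it Friedgut's theorem on the sharpness of the random `k`-SAT threshold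
(`RandomKSatSharpThreshold.lean`). We work on the product `ι → Ω` of a finite set `Ω` with the
UNIFORM probability measure (the case needed downstream: `Ω` = clauses, `ι` = clause slots), all
expectations being finite averages `avg g = (∑ x, g x) / |…|`.
-- TODO(general form): O'Donnell's `L²(Ωⁿ, π^{⊗n})` with a general product weight `π`.

* `avg`, `proj T f = f^{⊆T}` (O'Donnell Def. 8.27: average out the coordinates outside `T`),
  `pure S f = f^{=S} = ∑_{T ⊆ S} (-1)^{|S|-|T|} f^{⊆T}` (Def. 8.28 / Prop. 8.36 via Möbius
  inversion), `coordL i f = L_i f = f - E_i f`, `infl i f = Inf_i[f] = ‖L_i f‖₂²`,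
  `totalInfl f = I[f]`, `variance f`;
* the averaging identities `avg_comp_piecewise` (resampling a set of coordinates preserves the
  uniform measure), `proj_proj` (`E_T E_{T'} = E_{T ∩ T'}`), Möbius inversion `sum_pure_eq_proj`
  (`∑_{S ⊆ U} f^{=S} = f^{⊆U}`, so `f = ∑_S f^{=S}`), `proj_pure` (`(f^{=S})^{⊆T} = [S ⊆ T] f^{=S}`),
  orthogonality `avg_pure_mul_pure`, Parseval `avg_mul_eq_sum` / `avg_sq_eq_sum`,
  `coordL_eq_sum_pure` (`L_i f = ∑_{S ∋ i} f^{=S}`), `infl_eq_sum`, `totalInfl_eq_sum`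
  (`I[f] = ∑_S |S| ‖f^{=S}‖²`, Prop. 8.23/8.45), `variance_eq_sum`, `variance_le_totalInfl`
  (Poincaré), `abs_pure_le` (`|f^{=S}| ≤ 2^{|S|} ‖f‖_∞`, Exercise 8.19), and for `±1`-valued `f`
  `avg_abs_coordL_eq_infl` (Prop. 8.24) and `avg_rpow_coordL_le_infl`
  (`‖L_i f‖_{4/3}^{4/3} ≤ Inf_i[f]`, Exercise 8.10(b)).

Everything is a finite sum and is proved; no named facts.

## References

* R. O'Donnell, *Analysis of Boolean Functions*, Cambridge University Press, 2014, §8.3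
  (Defs. 8.27–8.28, Props. 8.31–8.36, 8.45), Prop. 8.24, Exercises 8.10, 8.19 [ODonnell2014].
-/

noncomputable section

namespace Literature.Computability.Complexity

namespace ProductSpace

open Finset Real

/-! ### Uniform averages -/

section Avg

variable {α : Type*} [Fintype α]

/-- The uniform average `E[g] = (∑ g)/|α|` of a real function on a finite type. [folklore] -/
def avg (g : α → ℝ) : ℝ := (∑ a, g a) / Fintype.card α

/-- Unfolding `avg`. [folklore] -/
theorem avg_def (g : α → ℝ) : avg g = (∑ a, g a) / Fintype.card α := rfl

/-- `avg` is additive. [folklore] -/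
theorem avg_add (g h : α → ℝ) : avg (fun a => g a + h a) = avg g + avg h := by
  simp only [avg, Finset.sum_add_distrib, add_div]

/-- `avg` of a difference. [folklore] -/
theorem avg_sub (g h : α → ℝ) : avg (fun a => g a - h a) = avg g - avg h := by
  simp only [avg, Finset.sum_sub_distrib, sub_div]

/-- `avg` of a negation. [folklore] -/
theorem avg_neg (g : α → ℝ) : avg (fun a => -g a) = -avg g := by
  simp only [avg, Finset.sum_neg_distrib, neg_div]

/-- Constants come out of `avg` (left). [folklore] -/
theorem avg_mul_left (c : ℝ) (g : α → ℝ) : avg (fun a => c * g a) = c * avg g := by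
  rw [avg, avg, ← Finset.mul_sum, mul_div_assoc]

/-- Constants come out of `avg` (right). [folklore] -/
theorem avg_mul_right (c : ℝ) (g : α → ℝ) : avg (fun a => g a * c) = avg g * c := by
  rw [avg, avg, ← Finset.sum_mul, div_mul_eq_mul_div]

/-- `avg` of a finite sum of functions. [folklore] -/
theorem avg_finset_sum {β : Type*} (s : Finset β) (g : β → α → ℝ) :
    avg (fun a => ∑ b ∈ s, g b a) = ∑ b ∈ s, avg (g b) := by
  simp only [avg, Finset.sum_div]
  rw [Finset.sum_comm]

/-- The average of a constant. [folklore] -/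
theorem avg_const [Nonempty α] (c : ℝ) : avg (fun _ : α => c) = c := by
  simp only [avg, Finset.sum_const, Finset.card_univ, nsmul_eq_mul]
  have : (Fintype.card α : ℝ) ≠ 0 := by exact_mod_cast Fintype.card_ne_zero
  field_simp

/-- The average of `0`. [folklore] -/
theorem avg_zero : avg (fun _ : α => (0 : ℝ)) = 0 := by simp [avg]

/-- `avg` is monotone. [folklore] -/
theorem avg_mono {g h : α → ℝ} (hgh : ∀ a, g a ≤ h a) : avg g ≤ avg h :=
  div_le_div_of_nonneg_right (Finset.sum_le_sum fun a _ => hgh a) (Nat.cast_nonneg _)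

/-- `avg` of a nonnegative function is nonnegative. [folklore] -/
theorem avg_nonneg {g : α → ℝ} (hg : ∀ a, 0 ≤ g a) : 0 ≤ avg g :=
  div_nonneg (Finset.sum_nonneg fun a _ => hg a) (Nat.cast_nonneg _)

/-- An average is at most a pointwise upper bound. [folklore] -/
theorem avg_le_of_le [Nonempty α] {g : α → ℝ} {c : ℝ} (hg : ∀ a, g a ≤ c) : avg g ≤ c :=
  (avg_mono hg).trans_eq (avg_const c)

/-- An average is at least a pointwise lower bound. [folklore] -/
theorem le_avg_of_le [Nonempty α] {g : α → ℝ} {c : ℝ} (hg : ∀ a, c ≤ g a) : c ≤ avg g :=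
  (avg_const c).symm.le.trans (avg_mono hg)

/-- `|avg g| ≤ avg |g|`. [folklore] -/
theorem abs_avg_le (g : α → ℝ) : |avg g| ≤ avg fun a => |g a| := by
  unfold avg
  rw [abs_div, Nat.abs_cast]
  exact div_le_div_of_nonneg_right (Finset.abs_sum_le_sum_abs _ _) (Nat.cast_nonneg _)

/-- Pointwise-equal functions have equal averages. [folklore] -/
theorem avg_congr {g h : α → ℝ} (hgh : ∀ a, g a = h a) : avg g = avg h := by
  simp only [avg, Finset.sum_congr rfl fun a _ => hgh a]

/-- Reindexing an average along an equivalence. [folklore] -/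
theorem avg_comp_equiv {β : Type*} [Fintype β] (e : α ≃ β) (g : β → ℝ) :
    avg (fun a => g (e a)) = avg g := by
  unfold avg
  rw [Equiv.sum_comp e g, Fintype.card_congr e]

/-- An average over a product is an iterated average. [folklore] -/
theorem avg_prod {β : Type*} [Fintype β] (F : α → β → ℝ) :
    avg (fun p : α × β => F p.1 p.2) = avg (fun a => avg (fun b => F a b)) := by
  unfold avg
  rw [Fintype.sum_prod_type, Fintype.card_prod, Nat.cast_mul, Finset.sum_div]
  rw [Finset.sum_div]
  refine Finset.sum_congr rfl fun a _ => ?_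
  rw [div_div, mul_comm]

/-- An average over a product, the other way. [folklore] -/
theorem avg_prod_comm {β : Type*} [Fintype β] (F : α → β → ℝ) :
    avg (fun p : α × β => F p.1 p.2) = avg (fun b => avg (fun a => F a b)) := by
  rw [← avg_comp_equiv (Equiv.prodComm β α) (fun p : α × β => F p.1 p.2)]
  exact avg_prod (fun b a => F a b)

/-- A function of the first factor averages over the product to its average. [folklore] -/
theorem avg_prod_fst {β : Type*} [Fintype β] [Nonempty β] (g : α → ℝ) :
    avg (fun p : α × β => g p.1) = avg g := by
  rw [avg_prod (fun a (_ : β) => g a)]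
  exact avg_congr fun a => avg_const (g a)

/-- Markov's inequality for a uniform average: `avg (1[g ≥ t]) ≤ avg g / t` for `g ≥ 0`. [folklore] -/
theorem avg_indicator_le_div {g : α → ℝ} (hg : ∀ a, 0 ≤ g a) {t : ℝ} (ht : 0 < t) :
    avg (fun a => if t ≤ g a then (1 : ℝ) else 0) ≤ avg g / t := by
  rw [le_div_iff₀ ht, ← avg_mul_right]
  refine avg_mono fun a => ?_
  split_ifs with h
  · simpa using h
  · simpa using hg a

/-- Cauchy–Schwarz for uniform averages. [folklore] -/
theorem avg_mul_le_sqrt (g h : α → ℝ) :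
    avg (fun a => g a * h a) ≤ Real.sqrt (avg fun a => g a ^ 2) * Real.sqrt (avg fun a => h a ^ 2) := by
  unfold avg
  have hN : (0 : ℝ) ≤ Fintype.card α := Nat.cast_nonneg _
  rw [Real.sqrt_div' _ hN, Real.sqrt_div' _ hN, div_mul_div_comm, Real.mul_self_sqrt hN]
  by_cases h0 : (Fintype.card α : ℝ) = 0
  · simp [h0]
  refine div_le_div_of_nonneg_right ?_ hN
  have := Real.sum_mul_le_sqrt_mul_sqrt (Finset.univ : Finset α) g h
  simpa only [Real.sqrt_eq_rpow] using this

/-- Jensen for squares: `(avg g)² ≤ avg g²`. [folklore] -/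
theorem sq_avg_le (g : α → ℝ) : avg g ^ 2 ≤ avg fun a => g a ^ 2 := by
  by_cases hα : Nonempty α
  · have h := avg_mul_le_sqrt g (fun _ => (1 : ℝ))
    simp only [mul_one, one_pow] at h
    rw [avg_const, Real.sqrt_one, mul_one] at h
    have h0 : 0 ≤ avg fun a => g a ^ 2 := avg_nonneg fun a => sq_nonneg _
    calc avg g ^ 2 ≤ (Real.sqrt (avg fun a => g a ^ 2)) ^ 2 := by
          apply sq_le_sq'
          · have := abs_avg_le g
            have h2 : avg (fun a => |g a|) ≤ Real.sqrt (avg fun a => g a ^ 2) := by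
              have h3 := avg_mul_le_sqrt (fun a => |g a|) (fun _ => (1 : ℝ))
              simp only [mul_one, one_pow, sq_abs] at h3
              rw [avg_const, Real.sqrt_one, mul_one] at h3
              exact h3
            have := neg_abs_le (avg g)
            linarith
          · exact h
      _ = avg fun a => g a ^ 2 := Real.sq_sqrt h0
  · simp only [not_nonempty_iff] at hα
    simp [avg, Finset.univ_eq_empty]

end Avg

/-! ### The averaging operators `f ↦ f^{⊆T}` -/

variable {ι Ω : Type*} [Fintype ι] [DecidableEq ι] [Fintype Ω] [Nonempty Ω]

/-- `f^{⊆T}(x) = E_y[f(x on T, y off T)]`: the coordinates outside `T` are averaged out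
(O'Donnell 2014, Def. 8.27, `f^{⊆T}`; for `T = {i}ᶜ` this is `E_i f`). [cite: ODonnell2014, Def. 8.27] -/
def proj (T : Finset ι) (f : (ι → Ω) → ℝ) (x : ι → Ω) : ℝ :=
  avg fun y : ι → Ω => f (T.piecewise x y)

/-- Keeping every coordinate: `f^{⊆univ} = f`. [cite: ODonnell2014, Def. 8.27] -/
theorem proj_univ (f : (ι → Ω) → ℝ) : proj Finset.univ f = f := by
  funext x
  simp only [proj, Finset.piecewise_univ]
  exact avg_const (f x)

omit [Nonempty Ω] in
/-- Keeping no coordinate: `f^{⊆∅} = E f`. [cite: ODonnell2014, Def. 8.27] -/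
theorem proj_empty (f : (ι → Ω) → ℝ) (x : ι → Ω) : proj ∅ f x = avg f := by
  simp only [proj, Finset.piecewise_empty]

omit [Nonempty Ω] in
/-- `f^{⊆T}` depends only on the coordinates in `T`. [cite: ODonnell2014, §8.3] -/
theorem proj_congr (T : Finset ι) (f : (ι → Ω) → ℝ) {x x' : ι → Ω}
    (h : ∀ i ∈ T, x i = x' i) : proj T f x = proj T f x' := by
  simp only [proj]
  refine avg_congr fun y => ?_
  rw [T.piecewise_congr (fun i hi => h i hi) (fun _ _ => rfl)]

omit [Nonempty Ω] in
/-- `f ↦ f^{⊆T}` is additive. [cite: ODonnell2014, §8.3] -/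
theorem proj_add (T : Finset ι) (f g : (ι → Ω) → ℝ) :
    proj T (fun x => f x + g x) = fun x => proj T f x + proj T g x := by
  funext x; exact avg_add _ _

omit [Nonempty Ω] in
/-- `f ↦ f^{⊆T}` respects differences. [cite: ODonnell2014, §8.3] -/
theorem proj_sub (T : Finset ι) (f g : (ι → Ω) → ℝ) :
    proj T (fun x => f x - g x) = fun x => proj T f x - proj T g x := by
  funext x; exact avg_sub _ _

omit [Nonempty Ω] in
/-- `f ↦ f^{⊆T}` is homogeneous. [cite: ODonnell2014, §8.3] -/
theorem proj_mul_left (T : Finset ι) (c : ℝ) (f : (ι → Ω) → ℝ) :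
    proj T (fun x => c * f x) = fun x => c * proj T f x := by
  funext x; exact avg_mul_left _ _

omit [Nonempty Ω] in
/-- `f ↦ f^{⊆T}` commutes with finite sums. [cite: ODonnell2014, §8.3] -/
theorem proj_finset_sum {β : Type*} (T : Finset ι) (s : Finset β) (g : β → (ι → Ω) → ℝ) :
    proj T (fun x => ∑ b ∈ s, g b x) = fun x => ∑ b ∈ s, proj T (g b) x := by
  funext x; exact avg_finset_sum s (fun b y => g b (T.piecewise x y))

/-- Constants are fixed by `f ↦ f^{⊆T}`. [cite: ODonnell2014, §8.3] -/
theorem proj_const (T : Finset ι) (c : ℝ) : proj T (fun _ : ι → Ω => c) = fun _ => c := by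
  funext x; exact avg_const c

omit [Nonempty Ω] in
/-- A factor depending only on the kept coordinates comes out of `f^{⊆T}`. [cite: ODonnell2014, §8.3] -/
theorem proj_mul_of_dep (T : Finset ι) (u v : (ι → Ω) → ℝ)
    (hv : ∀ x x' : ι → Ω, (∀ i ∈ T, x i = x' i) → v x = v x') :
    proj T (fun x => u x * v x) = fun x => proj T u x * v x := by
  funext x
  simp only [proj]
  rw [← avg_mul_right]
  refine avg_congr fun y => ?_
  rw [hv (T.piecewise x y) x (fun i hi => Finset.piecewise_eq_of_mem _ _ _ hi)]

/-- `|f^{⊆T}| ≤ ‖f‖_∞`. [cite: ODonnell2014, §8.3] -/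
theorem abs_proj_le (T : Finset ι) {f : (ι → Ω) → ℝ} {B : ℝ} (hf : ∀ x, |f x| ≤ B) (x : ι → Ω) :
    |proj T f x| ≤ B :=
  (abs_avg_le _).trans (avg_le_of_le fun _ => hf _)

omit [Nonempty Ω] in
/-- `f ↦ f^{⊆T}` is monotone. [cite: ODonnell2014, §8.3] -/
theorem proj_mono (T : Finset ι) {f g : (ι → Ω) → ℝ} (hfg : ∀ x, f x ≤ g x) (x : ι → Ω) :
    proj T f x ≤ proj T g x :=
  avg_mono fun _ => hfg _

/-- The involution `(y, z) ↦ (y|_A ∪ z|_{Aᶜ}, z|_A ∪ y|_{Aᶜ})` of pairs of points. [folklore] -/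
def swapEquiv (A : Finset ι) : ((ι → Ω) × (ι → Ω)) ≃ ((ι → Ω) × (ι → Ω)) where
  toFun p := (A.piecewise p.1 p.2, A.piecewise p.2 p.1)
  invFun p := (A.piecewise p.1 p.2, A.piecewise p.2 p.1)
  left_inv p := by
    apply Prod.ext <;> funext i <;> by_cases hi : i ∈ A <;> simp [Finset.piecewise, hi]
  right_inv p := by
    apply Prod.ext <;> funext i <;> by_cases hi : i ∈ A <;> simp [Finset.piecewise, hi]

/-- **Resampling preserves the uniform measure**: averaging `G(y|_A ∪ z|_{Aᶜ})` over independent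
uniform `y, z` is averaging `G`. [folklore] -/
theorem avg_comp_piecewise (A : Finset ι) (G : (ι → Ω) → ℝ) :
    avg (fun p : (ι → Ω) × (ι → Ω) => G (A.piecewise p.1 p.2)) = avg G := by
  have h1 : avg (fun p : (ι → Ω) × (ι → Ω) => G (A.piecewise p.1 p.2)) =
      avg (fun p : (ι → Ω) × (ι → Ω) => G ((swapEquiv (Ω := Ω) A) p).1) := rfl
  rw [h1, avg_comp_equiv (swapEquiv (Ω := Ω) A) (fun p => G p.1)]
  exact avg_prod_fst G

/-- The same, as an iterated average. [folklore] -/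
theorem avg_avg_piecewise (A : Finset ι) (G : (ι → Ω) → ℝ) :
    avg (fun y : ι → Ω => avg (fun z : ι → Ω => G (A.piecewise y z))) = avg G := by
  rw [← avg_prod (fun y z : ι → Ω => G (A.piecewise y z))]
  exact avg_comp_piecewise A G

/-- **`E_T E_{T'} = E_{T ∩ T'}`** (O'Donnell 2014, Exercise 8.11 / Prop. 8.31 style): averaging out
`Tᶜ` and then `T'ᶜ` averages out `(T ∩ T')ᶜ`. [cite: ODonnell2014, §8.3] -/
theorem proj_proj (T T' : Finset ι) (f : (ι → Ω) → ℝ) :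
    proj T (proj T' f) = proj (T ∩ T') f := by
  funext x
  simp only [proj]
  have key : ∀ y z : ι → Ω,
      T'.piecewise (T.piecewise x y) z = (T ∩ T').piecewise x (T'.piecewise y z) := by
    intro y z
    funext i
    by_cases h1 : i ∈ T <;> by_cases h2 : i ∈ T' <;> simp [Finset.piecewise, h1, h2]
  simp_rw [key]
  exact avg_avg_piecewise T' (fun u => f ((T ∩ T').piecewise x u))

/-- `E[f] = E[f^{⊆T}]`. [cite: ODonnell2014, §8.3] -/
theorem avg_proj (T : Finset ι) (f : (ι → Ω) → ℝ) : avg (proj T f) = avg f := by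
  have hne : Nonempty (ι → Ω) := inferInstance
  obtain ⟨x₀⟩ := hne
  have h1 : avg (proj T f) = proj ∅ (proj T f) x₀ := (proj_empty _ _).symm
  rw [h1, proj_proj, Finset.empty_inter, proj_empty]

/-! ### The pure components `f^{=S}` -/

/-- `f^{=S} = ∑_{T ⊆ S} (-1)^{|S|-|T|} f^{⊆T}` (O'Donnell 2014, Def. 8.28 with Prop. 8.36, the
Möbius-inverted form; we write the sign as `(-1)^{|S|+|T|}`). [cite: ODonnell2014, Def. 8.28, Prop. 8.36] -/
def pure (S : Finset ι) (f : (ι → Ω) → ℝ) (x : ι → Ω) : ℝ :=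
  ∑ T ∈ S.powerset, (-1 : ℝ) ^ (S.card + T.card) * proj T f x

omit [Fintype ι] [Nonempty Ω] in
/-- `∑_{R ⊆ V} (-1)^{|R|} = [V = ∅]` over `ℝ`. [folklore] -/
theorem sum_powerset_neg_one_pow_card_real (V : Finset ι) :
    ∑ R ∈ V.powerset, (-1 : ℝ) ^ R.card = if V = ∅ then 1 else 0 := by
  have h := (Finset.sum_powerset_neg_one_pow_card (x := V))
  split_ifs with hV
  · rw [if_pos hV] at h; exact_mod_cast h
  · rw [if_neg hV] at h; exact_mod_cast h

omit [Nonempty Ω] in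
/-- **Möbius inversion**: `∑_{S ⊆ U} f^{=S} = f^{⊆U}` (O'Donnell 2014, Prop. 8.36 / (8.8)).
[cite: ODonnell2014, Prop. 8.36] -/
theorem sum_pure_eq_proj (U : Finset ι) (f : (ι → Ω) → ℝ) (x : ι → Ω) :
    ∑ S ∈ U.powerset, pure S f x = proj U f x := by
  simp only [pure]
  -- swap the sums over the triangle `T ⊆ S ⊆ U`
  rw [Finset.sum_sigma' U.powerset fun S => S.powerset]
  have hswap : ∑ p ∈ U.powerset.sigma (fun S => S.powerset),
      (-1 : ℝ) ^ (p.1.card + p.2.card) * proj p.2 f x =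
      ∑ p ∈ U.powerset.sigma (fun T => (U \ T).powerset),
        (-1 : ℝ) ^ p.2.card * proj p.1 f x := by
    refine Finset.sum_bij' (fun p _ => ⟨p.2, p.1 \ p.2⟩) (fun p _ => ⟨p.1 ∪ p.2, p.1⟩) ?_ ?_ ?_ ?_ ?_
    · rintro ⟨S, T⟩ hp
      simp only [Finset.mem_sigma, Finset.mem_powerset] at hp ⊢
      exact ⟨hp.2.trans hp.1, Finset.sdiff_subset_sdiff hp.1 le_rfl⟩
    · rintro ⟨T, R⟩ hp
      simp only [Finset.mem_sigma, Finset.mem_powerset] at hp ⊢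
      refine ⟨Finset.union_subset hp.1 ((hp.2.trans Finset.sdiff_subset)), Finset.subset_union_left⟩
    · rintro ⟨S, T⟩ hp
      simp only [Finset.mem_sigma, Finset.mem_powerset] at hp
      simp only [Finset.union_sdiff_of_subset hp.2]
    · rintro ⟨T, R⟩ hp
      simp only [Finset.mem_sigma, Finset.mem_powerset] at hp
      have hdis : Disjoint T R := Finset.disjoint_of_subset_right hp.2 Finset.disjoint_sdiff
      simp only [Finset.union_sdiff_left, Finset.sdiff_eq_self_of_disjoint hdis.symm]
    · rintro ⟨S, T⟩ hp
      simp only [Finset.mem_sigma, Finset.mem_powerset] at hp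
      simp only
      rw [Finset.card_sdiff_of_subset hp.2]
      congr 1
      have hle : T.card ≤ S.card := Finset.card_le_card hp.2
      obtain ⟨d, hd⟩ := Nat.exists_eq_add_of_le hle
      rw [hd, Nat.add_sub_cancel_left, show T.card + d + T.card = d + 2 * T.card by ring, pow_add,
        pow_mul]
      norm_num
  rw [hswap, Finset.sum_sigma]
  simp only
  have hin : ∀ T ∈ U.powerset, ∑ R ∈ (U \ T).powerset, (-1 : ℝ) ^ R.card * proj T f x =
      if T = U then proj U f x else 0 := by
    intro T hT
    rw [← Finset.sum_mul, sum_powerset_neg_one_pow_card_real]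
    have hTU : T ⊆ U := Finset.mem_powerset.1 hT
    by_cases h : T = U
    · subst h; simp
    · have hne : U \ T ≠ ∅ := by
        intro he
        apply h
        exact Finset.Subset.antisymm hTU (Finset.sdiff_eq_empty_iff_subset.1 he)
      simp [hne, h]
  rw [Finset.sum_congr rfl hin, Finset.sum_ite_eq' U.powerset U (fun _ => proj U f x)]
  simp

/-- **The orthogonal decomposition** `f = ∑_S f^{=S}` (O'Donnell 2014, Def. 8.28 / Thm. 8.35).
[cite: ODonnell2014, Thm. 8.35] -/
theorem sum_pure (f : (ι → Ω) → ℝ) (x : ι → Ω) : ∑ S, pure S f x = f x := by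
  rw [← Finset.powerset_univ, sum_pure_eq_proj, proj_univ]

omit [Nonempty Ω] in
/-- `f^{=∅} = E f`. [cite: ODonnell2014, Def. 8.28] -/
theorem pure_empty (f : (ι → Ω) → ℝ) (x : ι → Ω) : pure ∅ f x = avg f := by
  simp [pure, proj_empty]

omit [Nonempty Ω] in
/-- `f^{=S}` depends only on the coordinates in `S`. [cite: ODonnell2014, Def. 8.28] -/
theorem pure_congr (S : Finset ι) (f : (ι → Ω) → ℝ) {x x' : ι → Ω}
    (h : ∀ i ∈ S, x i = x' i) : pure S f x = pure S f x' := by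
  simp only [pure]
  refine Finset.sum_congr rfl fun T hT => ?_
  rw [proj_congr T f (fun i hi => h i (Finset.mem_powerset.1 hT hi))]

omit [Nonempty Ω] in
/-- `f ↦ f^{=S}` is additive. [cite: ODonnell2014, Def. 8.28] -/
theorem pure_add (S : Finset ι) (f g : (ι → Ω) → ℝ) (x : ι → Ω) :
    pure S (fun y => f y + g y) x = pure S f x + pure S g x := by
  simp only [pure, proj_add, mul_add, Finset.sum_add_distrib]

omit [Nonempty Ω] in
/-- `f ↦ f^{=S}` respects differences. [cite: ODonnell2014, Def. 8.28] -/
theorem pure_sub (S : Finset ι) (f g : (ι → Ω) → ℝ) (x : ι → Ω) :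
    pure S (fun y => f y - g y) x = pure S f x - pure S g x := by
  simp only [pure, proj_sub, mul_sub, Finset.sum_sub_distrib]

omit [Nonempty Ω] in
/-- `f ↦ f^{=S}` is homogeneous. [cite: ODonnell2014, Def. 8.28] -/
theorem pure_mul_left (S : Finset ι) (c : ℝ) (f : (ι → Ω) → ℝ) (x : ι → Ω) :
    pure S (fun y => c * f y) x = c * pure S f x := by
  simp only [pure, proj_mul_left, Finset.mul_sum]
  refine Finset.sum_congr rfl fun T _ => ?_
  ring

/-- A constant has no nonempty pure component. [cite: ODonnell2014, Def. 8.28] -/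
theorem pure_const (S : Finset ι) (hS : S.Nonempty) (c : ℝ) (x : ι → Ω) :
    pure S (fun _ : ι → Ω => c) x = 0 := by
  simp only [pure, proj_const]
  have e : ∀ T ∈ S.powerset, (-1 : ℝ) ^ (S.card + T.card) * c = ((-1) ^ S.card * c) * (-1) ^ T.card := by
    intro T _; rw [pow_add]; ring
  rw [Finset.sum_congr rfl e, ← Finset.mul_sum, sum_powerset_neg_one_pow_card_real,
    if_neg (Finset.nonempty_iff_ne_empty.1 hS), mul_zero]

/-- **`(f^{=S})^{⊆T} = [S ⊆ T] · f^{=S}`** (O'Donnell 2014, Prop. 8.33 and Def. 8.28: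
`f^{=S}` is killed by averaging any of its coordinates and untouched by averaging the others).
[cite: ODonnell2014, Prop. 8.33] -/
theorem proj_pure (T S : Finset ι) (f : (ι → Ω) → ℝ) :
    proj T (pure S f) = if S ⊆ T then pure S f else fun _ => 0 := by
  have hlin : proj T (pure S f) = fun x => ∑ T' ∈ S.powerset,
      (-1 : ℝ) ^ (S.card + T'.card) * proj (T ∩ T') f x := by
    have e : pure S f = fun x => ∑ T' ∈ S.powerset, (-1 : ℝ) ^ (S.card + T'.card) * proj T' f x := rfl
    rw [e, proj_finset_sum]
    funext x
    refine Finset.sum_congr rfl fun T' _ => ?_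
    rw [proj_mul_left, proj_proj]
  rw [hlin]
  split_ifs with hST
  · funext x
    refine Finset.sum_congr rfl fun T' hT' => ?_
    rw [Finset.inter_eq_right.2 ((Finset.mem_powerset.1 hT').trans hST)]
  · funext x
    obtain ⟨i, hiS, hiT⟩ := Finset.not_subset.1 hST
    have hS : S = insert i (S.erase i) := (Finset.insert_erase hiS).symm
    rw [hS, Finset.sum_powerset_insert (Finset.notMem_erase i S)]
    rw [← Finset.sum_add_distrib]
    refine Finset.sum_eq_zero fun T' hT' => ?_
    have hiT' : i ∉ T' := fun h => Finset.notMem_erase i S (Finset.mem_powerset.1 hT' h)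
    have hint : T ∩ insert i T' = T ∩ T' := by
      rw [Finset.inter_insert_of_notMem hiT]
    rw [hint, Finset.card_insert_of_notMem hiT', ← add_assoc, pow_succ]
    ring

/-- `E_i f^{=S} = 0` for `i ∈ S`, in the form `(f^{=S})^{⊆{i}ᶜ} = 0`. [cite: ODonnell2014, Prop. 8.33] -/
theorem proj_compl_singleton_pure {i : ι} {S : Finset ι} (hi : i ∈ S) (f : (ι → Ω) → ℝ) :
    proj ({i}ᶜ) (pure S f) = fun _ => 0 := by
  rw [proj_pure, if_neg]
  intro h
  have := h hi
  simp at this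

/-- **Orthogonality**: `E[f^{=S} g^{=S'}] = 0` for `S ≠ S'` (O'Donnell 2014, Prop. 8.31/Thm. 8.35).
[cite: ODonnell2014, Thm. 8.35] -/
theorem avg_pure_mul_pure {S S' : Finset ι} (hSS' : S ≠ S') (f g : (ι → Ω) → ℝ) :
    avg (fun x => pure S f x * pure S' g x) = 0 := by
  -- a coordinate in the symmetric difference
  have key : ∀ {A B : Finset ι} (u v : (ι → Ω) → ℝ) {i : ι}, i ∈ A → i ∉ B →
      avg (fun x => pure A u x * pure B v x) = 0 := by
    intro A B u v i hiA hiB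
    rw [← avg_proj ({i}ᶜ)]
    rw [proj_mul_of_dep ({i}ᶜ) (pure A u) (pure B v) (fun x x' hx => pure_congr B v
      (fun j hj => hx j (by simp only [Finset.mem_compl, Finset.mem_singleton]; rintro rfl; exact hiB hj)))]
    rw [proj_compl_singleton_pure hiA]
    simp [avg_zero]
  by_cases h : S ⊆ S'
  · have hne : ¬ S' ⊆ S := fun h' => hSS' (Finset.Subset.antisymm h h')
    obtain ⟨i, hi', hi⟩ := Finset.not_subset.1 hne
    have := key g f hi' hi
    rw [← this]
    exact avg_congr fun x => mul_comm _ _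
  · obtain ⟨i, hi, hi'⟩ := Finset.not_subset.1 h
    exact key f g hi hi'

/-- **Parseval/Plancherel in coefficients**: for two combinations of the pure components of `f`,
`E[(∑_S a_S f^{=S})(∑_S b_S f^{=S})] = ∑_S a_S b_S ‖f^{=S}‖₂²`. [cite: ODonnell2014, Thm. 8.35] -/
theorem avg_sum_mul_sum (a b : Finset ι → ℝ) (f : (ι → Ω) → ℝ) :
    avg (fun x => (∑ S, a S * pure S f x) * (∑ S, b S * pure S f x)) =
      ∑ S, a S * b S * avg (fun x => pure S f x ^ 2) := by
  have e : ∀ x : ι → Ω, (∑ S, a S * pure S f x) * (∑ S, b S * pure S f x) =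
      ∑ S, ∑ S', a S * b S' * (pure S f x * pure S' f x) := by
    intro x
    rw [Finset.sum_mul_sum]
    refine Finset.sum_congr rfl fun S _ => Finset.sum_congr rfl fun S' _ => ?_
    ring
  simp_rw [e]
  rw [avg_finset_sum]
  refine Finset.sum_congr rfl fun S _ => ?_
  rw [avg_finset_sum]
  rw [Finset.sum_eq_single S]
  · rw [avg_mul_left]
    congr 1
    exact avg_congr fun x => by ring
  · intro S' _ hS'
    rw [avg_mul_left, avg_pure_mul_pure (Ne.symm hS'), mul_zero]
  · intro h; exact absurd (Finset.mem_univ S) h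

/-- **Parseval**: `E[f²] = ∑_S ‖f^{=S}‖₂²`. [cite: ODonnell2014, Thm. 8.35] -/
theorem avg_sq_eq_sum (f : (ι → Ω) → ℝ) :
    avg (fun x => f x ^ 2) = ∑ S, avg (fun x => pure S f x ^ 2) := by
  have h := avg_sum_mul_sum (fun _ => (1 : ℝ)) (fun _ => (1 : ℝ)) f
  simp only [one_mul] at h
  rw [← h]
  exact avg_congr fun x => by rw [sum_pure, sq]

/-! ### Influences, total influence, variance -/

/-- `L_i f = f - E_i f` (O'Donnell 2014, Def. 8.27). [cite: ODonnell2014, Def. 8.27] -/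
def coordL (i : ι) (f : (ι → Ω) → ℝ) (x : ι → Ω) : ℝ := f x - proj ({i}ᶜ) f x

/-- `Inf_i[f] = ‖L_i f‖₂²` (O'Donnell 2014, Def. 8.22). [cite: ODonnell2014, Def. 8.22] -/
def infl (i : ι) (f : (ι → Ω) → ℝ) : ℝ := avg fun x => coordL i f x ^ 2

/-- `I[f] = ∑_i Inf_i[f]` (O'Donnell 2014, Def. 8.22). [cite: ODonnell2014, Def. 8.22] -/
def totalInfl (f : (ι → Ω) → ℝ) : ℝ := ∑ i, infl i f

/-- `Var[f] = E[f²] - E[f]²`. [folklore] -/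
def variance (f : (ι → Ω) → ℝ) : ℝ := avg (fun x => f x ^ 2) - avg f ^ 2

omit [Nonempty Ω] in
/-- Influences are nonnegative. [cite: ODonnell2014, Def. 8.22] -/
theorem infl_nonneg (i : ι) (f : (ι → Ω) → ℝ) : 0 ≤ infl i f := avg_nonneg fun _ => sq_nonneg _

omit [Nonempty Ω] in
/-- Total influence is nonnegative. [cite: ODonnell2014, Def. 8.22] -/
theorem totalInfl_nonneg (f : (ι → Ω) → ℝ) : 0 ≤ totalInfl f :=
  Finset.sum_nonneg fun i _ => infl_nonneg i f

/-- `E_i f = ∑_{S ∌ i} f^{=S}`. [cite: ODonnell2014, Prop. 8.33] -/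
theorem proj_compl_singleton_eq_sum (i : ι) (f : (ι → Ω) → ℝ) (x : ι → Ω) :
    proj ({i}ᶜ) f x = ∑ S ∈ Finset.univ.filter (fun S => i ∉ S), pure S f x := by
  have h1 : proj ({i}ᶜ) f = proj ({i}ᶜ) (fun y => ∑ S, pure S f y) := by
    congr 1; funext y; rw [sum_pure]
  rw [h1, proj_finset_sum]
  simp only
  rw [Finset.sum_filter]
  refine Finset.sum_congr rfl fun S _ => ?_
  rw [proj_pure]
  have : S ⊆ {i}ᶜ ↔ i ∉ S := by
    rw [Finset.subset_compl_iff_disjoint_right, Finset.disjoint_singleton_right]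
  by_cases hi : i ∈ S
  · rw [if_neg (fun h => (this.1 h) hi), if_neg (not_not.2 hi)]
  · rw [if_pos (this.2 hi), if_pos hi]

/-- **`L_i f = ∑_{S ∋ i} f^{=S}`** (O'Donnell 2014, Prop. 8.33). [cite: ODonnell2014, Prop. 8.33] -/
theorem coordL_eq_sum_pure (i : ι) (f : (ι → Ω) → ℝ) (x : ι → Ω) :
    coordL i f x = ∑ S ∈ Finset.univ.filter (fun S => i ∈ S), pure S f x := by
  unfold coordL
  rw [proj_compl_singleton_eq_sum, ← sum_pure f x]
  rw [← Finset.sum_filter_add_sum_filter_not Finset.univ (fun S => i ∈ S) (fun S => pure S f x)]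
  ring

/-- `L_i f` as a full sum with indicator coefficients. [cite: ODonnell2014, Prop. 8.33] -/
theorem coordL_eq_sum_ite (i : ι) (f : (ι → Ω) → ℝ) (x : ι → Ω) :
    coordL i f x = ∑ S, (if i ∈ S then (1 : ℝ) else 0) * pure S f x := by
  rw [coordL_eq_sum_pure, Finset.sum_filter]
  refine Finset.sum_congr rfl fun S _ => ?_
  split_ifs <;> simp

/-- **`Inf_i[f] = ∑_{S ∋ i} ‖f^{=S}‖₂²`** (O'Donnell 2014, Prop. 8.23/8.45). [cite: ODonnell2014, Prop. 8.45] -/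
theorem infl_eq_sum (i : ι) (f : (ι → Ω) → ℝ) :
    infl i f = ∑ S, (if i ∈ S then (1 : ℝ) else 0) * avg (fun x => pure S f x ^ 2) := by
  unfold infl
  have h := avg_sum_mul_sum (fun S => if i ∈ S then (1 : ℝ) else 0)
    (fun S => if i ∈ S then (1 : ℝ) else 0) f
  have e : (fun x => coordL i f x ^ 2) = fun x =>
      (∑ S, (if i ∈ S then (1 : ℝ) else 0) * pure S f x) *
        (∑ S, (if i ∈ S then (1 : ℝ) else 0) * pure S f x) := by
    funext x; rw [coordL_eq_sum_ite, sq]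
  rw [e, h]
  refine Finset.sum_congr rfl fun S _ => ?_
  split_ifs <;> simp

/-- **`I[f] = ∑_S |S| ‖f^{=S}‖₂²`** (O'Donnell 2014, Prop. 8.45). [cite: ODonnell2014, Prop. 8.45] -/
theorem totalInfl_eq_sum (f : (ι → Ω) → ℝ) :
    totalInfl f = ∑ S : Finset ι, (S.card : ℝ) * avg (fun x => pure S f x ^ 2) := by
  unfold totalInfl
  simp_rw [infl_eq_sum]
  rw [Finset.sum_comm]
  refine Finset.sum_congr rfl fun S _ => ?_
  rw [← Finset.sum_mul]
  congr 1
  rw [Finset.sum_boole]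
  simp

/-- `E[f] ² = ‖f^{=∅}‖₂²`. [cite: ODonnell2014, §8.3] -/
theorem avg_pure_empty_sq (f : (ι → Ω) → ℝ) : avg (fun x => pure ∅ f x ^ 2) = avg f ^ 2 := by
  simp only [pure_empty]
  exact avg_const _

/-- **`Var[f] = ∑_{S ≠ ∅} ‖f^{=S}‖₂²`**. [cite: ODonnell2014, §8.3] -/
theorem variance_eq_sum (f : (ι → Ω) → ℝ) :
    variance f = ∑ S ∈ Finset.univ.filter (fun S : Finset ι => S ≠ ∅), avg (fun x => pure S f x ^ 2) := by
  unfold variance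
  rw [avg_sq_eq_sum, ← avg_pure_empty_sq, Finset.filter_ne',
    ← Finset.sum_erase_add _ _ (Finset.mem_univ ∅)]
  ring

/-- Variance is nonnegative. [folklore] -/
theorem variance_nonneg (f : (ι → Ω) → ℝ) : 0 ≤ variance f := by
  rw [variance_eq_sum]; exact Finset.sum_nonneg fun S _ => avg_nonneg fun _ => sq_nonneg _

/-- **Poincaré inequality** `Var[f] ≤ I[f]`. [cite: ODonnell2014, §8.3] -/
theorem variance_le_totalInfl (f : (ι → Ω) → ℝ) : variance f ≤ totalInfl f := by
  rw [variance_eq_sum, totalInfl_eq_sum, Finset.sum_filter]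
  refine Finset.sum_le_sum fun S _ => ?_
  have h0 : 0 ≤ avg (fun x => pure S f x ^ 2) := avg_nonneg fun _ => sq_nonneg _
  split_ifs with h
  · have : (1 : ℝ) ≤ S.card := by
      exact_mod_cast Finset.card_pos.2 (Finset.nonempty_iff_ne_empty.2 h)
    nlinarith
  · positivity

/-- The tail of the spectrum beyond level `L` is at most `I[f]/(L+1)` (O'Donnell 2014, Prop. 3.2,
"Markov argument"). [cite: ODonnell2014, Prop. 3.2] -/
theorem sum_filter_card_gt_le (f : (ι → Ω) → ℝ) (L : ℕ) :
    ∑ S ∈ Finset.univ.filter (fun S : Finset ι => L < S.card), avg (fun x => pure S f x ^ 2) ≤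
      totalInfl f / (L + 1) := by
  rw [totalInfl_eq_sum, le_div_iff₀ (by positivity), Finset.sum_filter, Finset.sum_mul]
  refine Finset.sum_le_sum fun S _ => ?_
  have h0 : 0 ≤ avg (fun x => pure S f x ^ 2) := avg_nonneg fun _ => sq_nonneg _
  split_ifs with h
  · have : (L : ℝ) + 1 ≤ S.card := by exact_mod_cast h
    nlinarith
  · simp only [zero_mul]; positivity

/-- `|f^{=S}| ≤ 2^{|S|} ‖f‖_∞` (O'Donnell 2014, Exercise 8.19). [cite: ODonnell2014, Exercise 8.19] -/
theorem abs_pure_le (S : Finset ι) {f : (ι → Ω) → ℝ} {B : ℝ} (hf : ∀ x, |f x| ≤ B) (x : ι → Ω) :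
    |pure S f x| ≤ 2 ^ S.card * B := by
  unfold pure
  calc |∑ T ∈ S.powerset, (-1 : ℝ) ^ (S.card + T.card) * proj T f x|
      ≤ ∑ T ∈ S.powerset, |(-1 : ℝ) ^ (S.card + T.card) * proj T f x| := Finset.abs_sum_le_sum_abs _ _
    _ ≤ ∑ _T ∈ S.powerset, B := by
        refine Finset.sum_le_sum fun T _ => ?_
        rw [abs_mul, abs_pow, abs_neg, abs_one, one_pow, one_mul]
        exact abs_proj_le T hf x
    _ = 2 ^ S.card * B := by rw [Finset.sum_const, Finset.card_powerset, nsmul_eq_mul]; push_cast; ring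

/-- Centering does not change the nonconstant components: `(f - E f)^{=S} = f^{=S}` for `S ≠ ∅`.
[cite: ODonnell2014, §8.3] -/
theorem pure_sub_avg {S : Finset ι} (hS : S.Nonempty) (f : (ι → Ω) → ℝ) (x : ι → Ω) :
    pure S (fun y => f y - avg f) x = pure S f x := by
  rw [pure_sub, pure_const S hS, sub_zero]

omit [Nonempty Ω] in
/-- For a mean-zero `g`, `g^{=S}(x) = ∑_{∅ ≠ T ⊆ S} (-1)^{|S|-|T|} g^{⊆T}(x)` (the `T = ∅` term is
`E g = 0`; O'Donnell 2014, proof of Bourgain's theorem, last display). [cite: ODonnell2014, §10.5] -/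
theorem pure_eq_sum_filter_nonempty (S : Finset ι) {g : (ι → Ω) → ℝ} (hg : avg g = 0) (x : ι → Ω) :
    pure S g x = ∑ T ∈ S.powerset.filter (fun T => T ≠ ∅), (-1 : ℝ) ^ (S.card + T.card) * proj T g x := by
  unfold pure
  rw [Finset.sum_filter]
  refine Finset.sum_congr rfl fun T _ => ?_
  split_ifs with h
  · rfl
  · simp only [ne_eq, not_not] at h
    rw [h, proj_empty, hg, mul_zero]

/-! ### `±1`-valued functions -/

/-- For `±1`-valued `f`: `E_i |L_i f| = E_i (L_i f)²` pointwise in the fiber, hence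
**`‖L_i f‖₁ = Inf_i[f]`** (O'Donnell 2014, Prop. 8.24). [cite: ODonnell2014, Prop. 8.24] -/
theorem avg_abs_coordL_eq_infl (i : ι) {f : (ι → Ω) → ℝ} (hf : ∀ x, f x = 1 ∨ f x = -1) :
    avg (fun x => |coordL i f x|) = infl i f := by
  -- pointwise: `|f - μ| = 1 - f μ` and `(f - μ)² = 1 - 2 f μ + μ²` with `μ = E_i f`, `|μ| ≤ 1`
  have hμ : ∀ x, |proj ({i}ᶜ) f x| ≤ 1 := fun x => abs_proj_le _ (fun y => by
    rcases hf y with h | h <;> simp [h]) x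
  have h1 : ∀ x, |coordL i f x| = 1 - f x * proj ({i}ᶜ) f x := by
    intro x
    have hμx := abs_le.1 (hμ x)
    unfold coordL
    rcases hf x with h | h
    · rw [h, one_mul, abs_of_nonneg (by linarith)]
    · rw [h, abs_of_nonpos (by linarith)]; ring
  have h2 : ∀ x, coordL i f x ^ 2 = 1 - 2 * (f x * proj ({i}ᶜ) f x) + proj ({i}ᶜ) f x ^ 2 := by
    intro x
    unfold coordL
    have : f x ^ 2 = 1 := by rcases hf x with h | h <;> simp [h]
    nlinarith [this]
  unfold infl
  simp_rw [h1, h2]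
  -- average over the fiber of `i` first: `E_i (f · μ) = μ²`
  have hdep : ∀ x x' : ι → Ω, (∀ j ∈ ({i}ᶜ : Finset ι), x j = x' j) →
      proj ({i}ᶜ) f x = proj ({i}ᶜ) f x' := fun x x' h => proj_congr _ f h
  have hfib : proj ({i}ᶜ) (fun x => f x * proj ({i}ᶜ) f x) = fun x => proj ({i}ᶜ) f x ^ 2 := by
    rw [proj_mul_of_dep _ _ _ hdep]; funext x; ring
  rw [← avg_proj ({i}ᶜ) (fun x => 1 - f x * proj ({i}ᶜ) f x),
    ← avg_proj ({i}ᶜ) (fun x => 1 - 2 * (f x * proj ({i}ᶜ) f x) + proj ({i}ᶜ) f x ^ 2)]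
  refine avg_congr fun x => ?_
  have hsq : proj ({i}ᶜ) (fun x => proj ({i}ᶜ) f x ^ 2) = fun x => proj ({i}ᶜ) f x ^ 2 := by
    have := proj_mul_of_dep ({i}ᶜ) (fun _ => (1 : ℝ)) (fun x => proj ({i}ᶜ) f x ^ 2)
      (fun x x' h => by rw [hdep x x' h])
    simp only [one_mul] at this
    rw [this, proj_const]; funext x; ring
  rw [proj_sub, proj_add, proj_sub, proj_mul_left, hfib, hsq, proj_const]
  simp only
  ring

/-- **`‖L_i f‖_{4/3}^{4/3} ≤ Inf_i[f]`** for `±1`-valued `f` (O'Donnell 2014, Exercise 8.10(b); by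
Hölder between `‖L_i f‖₁ = Inf_i[f]` and `‖L_i f‖₂² = Inf_i[f]`).
[cite: ODonnell2014, Exercise 8.10(b)] -/
theorem avg_rpow_coordL_le_infl (i : ι) {f : (ι → Ω) → ℝ} (hf : ∀ x, f x = 1 ∨ f x = -1) :
    avg (fun x => |coordL i f x| ^ (4 / 3 : ℝ)) ≤ infl i f := by
  set h : (ι → Ω) → ℝ := fun x => coordL i f x with hh
  have hN0 : (0 : ℝ) < Fintype.card (ι → Ω) := by exact_mod_cast Fintype.card_pos
  -- Hölder with exponents `3/2` and `3` on `|h|^{2/3} · |h|^{2/3}`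
  have hH := Real.inner_le_Lp_mul_Lq (Finset.univ : Finset (ι → Ω))
    (fun x => |h x| ^ (2 / 3 : ℝ)) (fun x => |h x| ^ (2 / 3 : ℝ))
    (Real.holderConjugate_iff.2 ⟨by norm_num, by norm_num⟩ : (3 / 2 : ℝ).HolderConjugate 3)
  have e1 : ∀ x, |h x| ^ (2 / 3 : ℝ) * |h x| ^ (2 / 3 : ℝ) = |h x| ^ (4 / 3 : ℝ) := by
    intro x; rw [← Real.rpow_add' (abs_nonneg _) (by norm_num)]; norm_num
  have e2 : ∀ x, |(|h x| ^ (2 / 3 : ℝ))| ^ (3 / 2 : ℝ) = |h x| := by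
    intro x
    rw [abs_of_nonneg (Real.rpow_nonneg (abs_nonneg _) _), ← Real.rpow_mul (abs_nonneg _)]
    norm_num
  have e3 : ∀ x, |(|h x| ^ (2 / 3 : ℝ))| ^ (3 : ℝ) = h x ^ 2 := by
    intro x
    rw [abs_of_nonneg (Real.rpow_nonneg (abs_nonneg _) _), ← Real.rpow_mul (abs_nonneg _)]
    norm_num
  simp only [e1, e2, e3] at hH
  -- `∑ |h| = N · Inf`, `∑ h² = N · Inf`
  have hs1 : ∑ x, |h x| = Fintype.card (ι → Ω) * infl i f := by
    rw [← avg_abs_coordL_eq_infl i hf, avg, mul_div_cancel₀ _ hN0.ne']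
  have hs2 : ∑ x, h x ^ 2 = Fintype.card (ι → Ω) * infl i f := by
    have : infl i f = avg fun x => h x ^ 2 := rfl
    rw [this, avg, mul_div_cancel₀ _ hN0.ne']
  rw [hs1, hs2] at hH
  have hI0 : 0 ≤ infl i f := infl_nonneg i f
  have hrhs : ((Fintype.card (ι → Ω) : ℝ) * infl i f) ^ (1 / (3 / 2 : ℝ)) *
      ((Fintype.card (ι → Ω) : ℝ) * infl i f) ^ (1 / (3 : ℝ)) = Fintype.card (ι → Ω) * infl i f := by
    rw [← Real.rpow_add' (by positivity) (by norm_num)]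
    norm_num
  rw [hrhs] at hH
  unfold avg
  rw [div_le_iff₀ hN0]
  linarith

end ProductSpace

end Literature.Computability.Complexity

end
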